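import Literature.Geometry.Lorentzian.KerrSchildMultiplierPerturbation
import Literature.Geometry.Lorentzian.KerrSchildKillingEnergy
import Literature.Geometry.Lorentzian.KerrEnergyIdentity
import Literature.Geometry.Lorentzian.KerrLargeRCurrent
import Summits.FinalStateConjecture.FinalStateConjecture.Theorems.ClusterCompletenessAdiabaticMultiKerrILEDHardyCurrent
import Summits.FinalStateConjecture.FinalStateConjecture.Theorems.ClusterCompletenessAdiabaticMultiKerrILEDMorawetzWeight

/-!
# Crux `AdiabaticMultiKerrILED` (line `Sketch`) — the leaf flux of the total Morawetz current
# of the tails-cut Schwarzschild zone is bounded by the energy density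

Helper file for the crux `stmt-FinalStateConjecture-14310`
(`Summit.FinalStateConjecture.FinalStateConjecture.Theses.ClusterCompleteness.AdiabaticMultiKerrILED`),
line `Sketch`, stub `morawetz_leafFlux_abs_le` (lead c7, wave 5, Morawetz integration).

Rest frame, zero spin: `G₀ = η⁻¹ − μ ℓ♯ ⊗ ℓ♯`, `μ = χ(2 − r/8M) · 2M/r`, `r = Kerr.radius 0 x`,
`χ = Real.smoothTransition`; total current `J_tot = J^X + ¼ L^{ϖ₂} + J_H + J^T` of the degenerate
Morawetz estimate (`X = (1 − 3M/r) ∂_{r*}`, `(∂_{r*})⁰ = μ`, `(∂_{r*})ⁱ = (1 − μ) xⁱ/r`,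
`ϖ₂(r) = 2(1 − 2M/r)((2r − 3M)/r² − M³(r − 3M)²/r⁶)`, `J_H = ½ ŷ(r) Φ² ∂_{r*}`, `J^T` Killing).
This file proves the **leaf estimate** `|∑_μ J_tot^μ n_μ| ≤ K (∑_μ (∂_μΦ)² + Φ²/r²)` on `{r > 2M}`
for conormals `n = (1, n⃗)`, `∑ nᵢ² ≤ ¼` (`morawetz_leafFlux_abs_le`, `K = 7208`), from the pointwise
bounds `|G₀^{μν}| ≤ 2`, `|X^μ|, |(∂_{r*})^μ|, |n_μ| ≤ 1`, `|ϖ₂| ≤ 8/r`, `|∂ϖ₂| ≤ 20/r²`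
(`hasDerivAt_morawetzWeight` and shifted-variable positivity), `|ŷ| ≤ 3500/r²`, and the abstract
estimate `morawetzLeaf_abs_sum_le_general`. Dafermos–Rodnianski–Shlapentokh-Rothman
arXiv:1402.7034, §2.3.2; Dafermos–Rodnianski arXiv:0811.0354, §4.1. [folklore]
-/

noncomputable section

-- the doubled `FinalStateConjecture.FinalStateConjecture` path component trips dupNamespace
set_option linter.dupNamespace false

open scoped BigOperators
open Literature.Geometry.Lorentzian

namespace Summit.FinalStateConjecture.FinalStateConjecture.Theorems

/-! ### The abstract leaf estimate -/

/-- `|∑_{μ<4} f_μ n_μ| ≤ 4B` when `|f_μ| ≤ B` and `|n_μ| ≤ 1`. [folklore] -/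
theorem morawetzLeaf_abs_sum_mul_le {f n : Fin 4 → ℝ} {B : ℝ} (hf : ∀ μ, |f μ| ≤ B)
    (hn : ∀ μ, |n μ| ≤ 1) : |∑ μ, f μ * n μ| ≤ 4 * B := by
  have hB : 0 ≤ B := (abs_nonneg _).trans (hf 0)
  calc |∑ μ, f μ * n μ| ≤ ∑ μ, |f μ * n μ| := Finset.abs_sum_le_sum_abs _ _
    _ ≤ ∑ _μ : Fin 4, B := Finset.sum_le_sum fun μ _ ↦ by
        rw [abs_mul]
        exact (mul_le_mul (hf μ) (hn μ) (abs_nonneg _) hB).trans_eq (mul_one B)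
    _ = 4 * B := by
        rw [Finset.sum_const, Finset.card_univ, Fintype.card_fin, nsmul_eq_mul, Nat.cast_ofNat]

/-- **Abstract leaf estimate for a total Morawetz current.** For a coefficient field with
`|G^{αβ}(x)| ≤ 2`, a multiplier with `|X^α(x)| ≤ 1`, a conormal with `|n_μ| ≤ 1`, a direction field
`|Y^μ| ≤ 1`, a Lagrangian weight with `|ϖ(x)| ≤ c_ϖ/r`, `|∂_νϖ(x)| ≤ c_d/r²` and a Hardy weight
`|ŷ| ≤ c_y/r²`: `|∑_μ (J^X + ¼ L^ϖ + ½ ŷ Φ² Y + J^T)^μ n_μ| ≤ (96 + 4c_ϖ + 4c_d + 2c_y)(∑(∂Φ)² + Φ²/r²)`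
(`|J^X·n|, |J^T·n| ≤ 48 ∑(∂Φ)²` by `KerrSchild.abs_sum_multiplierCurrent_mul_le_of_coeff`,
`|L^μ| ≤ 2|ϖ||Φ|∑|∂Φ| + Φ² ∑|∂ϖ|`, `2ab ≤ a² + b²`, `(∑|∂Φ|)² ≤ 4∑(∂Φ)²`).
Dafermos–Rodnianski–Shlapentokh-Rothman arXiv:1402.7034, §2.3.2. [folklore] -/
theorem morawetzLeaf_abs_sum_le_general (G : E4 → Fin 4 → Fin 4 → ℝ) (X : E4 → Fin 4 → ℝ)
    (ϖ Φ : E4 → ℝ) (x : E4) (n Y : Fin 4 → ℝ) {yv r cϖ cd cy : ℝ} (hr : 0 < r)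
    (hcϖ : 0 ≤ cϖ) (hcd : 0 ≤ cd) (hcy : 0 ≤ cy)
    (hG : ∀ α β, |G x α β| ≤ 2) (hX : ∀ α, |X x α| ≤ 1) (hn : ∀ μ, |n μ| ≤ 1)
    (hY : ∀ μ, |Y μ| ≤ 1) (hϖ : |ϖ x| ≤ cϖ / r)
    (hdϖ : ∀ ν, |fderiv ℝ ϖ x (E4.basisVector ν)| ≤ cd / r ^ 2) (hy : |yv| ≤ cy / r ^ 2) :
    |∑ μ, (KerrSchild.multiplierCurrent G X Φ x μ +
        4⁻¹ * KerrSchild.lagrangianCurrent G ϖ Φ x μ + 2⁻¹ * yv * Φ x ^ 2 * Y μ +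
        KerrSchild.multiplierCurrent G KerrSchild.timeField Φ x μ) * n μ| ≤
      (96 + 4 * cϖ + 4 * cd + 2 * cy) *
        (∑ μ, fderiv ℝ Φ x (E4.basisVector μ) ^ 2 + Φ x ^ 2 / r ^ 2) := by
  -- the two vector-field currents
  have hT : ∀ α, |KerrSchild.timeField x α| ≤ 1 := fun α ↦ by
    unfold KerrSchild.timeField
    split_ifs <;> simp
  have hJX := KerrSchild.abs_sum_multiplierCurrent_mul_le_of_coeff G X Φ x n zero_le_two
    zero_le_one zero_le_one hG hX hn
  have hJT := KerrSchild.abs_sum_multiplierCurrent_mul_le_of_coeff G KerrSchild.timeField Φ x n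
    zero_le_two zero_le_one zero_le_one hG hT hn
  -- name the atoms
  obtain ⟨p, hp⟩ : ∃ p : Fin 4 → ℝ, ∀ β, fderiv ℝ Φ x (E4.basisVector β) = p β := ⟨_, fun _ ↦ rfl⟩
  obtain ⟨d, hd⟩ : ∃ d : Fin 4 → ℝ, ∀ β, fderiv ℝ ϖ x (E4.basisVector β) = d β := ⟨_, fun _ ↦ rfl⟩
  simp only [hp] at hJX hJT ⊢
  set S : ℝ := ∑ μ, p μ ^ 2 with hS
  set P : ℝ := ∑ μ, |p μ| with hP
  set Q : ℝ := Φ x ^ 2 / r ^ 2 with hQ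
  have hS0 : 0 ≤ S := Finset.sum_nonneg fun μ _ ↦ sq_nonneg _
  have hP0 : 0 ≤ P := Finset.sum_nonneg fun μ _ ↦ abs_nonneg _
  have hQ0 : 0 ≤ Q := by positivity
  have hP2 : P ^ 2 ≤ 4 * S := Kerr.sq_sum_abs_le_four_mul p
  -- the Lagrangian current, component by component
  have hA : ∀ μ, |∑ ν, G x μ ν * p ν| ≤ 2 * P := fun μ ↦ KerrSchild.abs_contract_le (G x) p hG μ
  have hD : ∀ μ, |∑ ν, G x μ ν * d ν| ≤ 2 * (4 * (cd / r ^ 2)) := fun μ ↦ by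
    refine (KerrSchild.abs_contract_le (G x) d hG μ).trans (mul_le_mul_of_nonneg_left ?_ zero_le_two)
    calc ∑ ν, |d ν| ≤ ∑ _ν : Fin 4, cd / r ^ 2 := Finset.sum_le_sum fun ν _ ↦ (hd ν) ▸ hdϖ ν
      _ = 4 * (cd / r ^ 2) := by
          rw [Finset.sum_const, Finset.card_univ, Fintype.card_fin, nsmul_eq_mul, Nat.cast_ofNat]
  have hL : ∀ μ, |KerrSchild.lagrangianCurrent G ϖ Φ x μ| ≤ 4 * cϖ * S + (cϖ + 4 * cd) * Q := by
    intro μ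
    simp only [KerrSchild.lagrangianCurrent, hp, hd]
    have h1 : |ϖ x * Φ x * ∑ ν, G x μ ν * p ν| ≤ cϖ / r * |Φ x| * (2 * P) := by
      rw [abs_mul, abs_mul]
      exact mul_le_mul (mul_le_mul_of_nonneg_right hϖ (abs_nonneg _)) (hA μ) (abs_nonneg _)
        (by positivity)
    have h2 : |2⁻¹ * Φ x ^ 2 * ∑ ν, G x μ ν * d ν| ≤
        2⁻¹ * Φ x ^ 2 * (2 * (4 * (cd / r ^ 2))) := by
      rw [abs_mul, abs_mul, abs_of_pos (by norm_num : (0 : ℝ) < 2⁻¹), abs_of_nonneg (sq_nonneg _)]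
      exact mul_le_mul_of_nonneg_left (hD μ) (by positivity)
    have h3 : cϖ / r * |Φ x| * (2 * P) ≤ cϖ * (Q + 4 * S) := by
      have hu : cϖ / r * |Φ x| * (2 * P) = cϖ * (2 * (|Φ x| / r) * P) := by ring
      have hsq : (|Φ x| / r) ^ 2 = Q := by rw [hQ, div_pow, sq_abs]
      have ham := two_mul_le_add_sq (|Φ x| / r) P
      rw [hsq] at ham
      rw [hu]
      exact mul_le_mul_of_nonneg_left (by linarith) hcϖ
    calc |ϖ x * Φ x * ∑ ν, G x μ ν * p ν - 2⁻¹ * Φ x ^ 2 * ∑ ν, G x μ ν * d ν|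
        ≤ |ϖ x * Φ x * ∑ ν, G x μ ν * p ν| + |2⁻¹ * Φ x ^ 2 * ∑ ν, G x μ ν * d ν| :=
          abs_sub _ _
      _ ≤ cϖ * (Q + 4 * S) + 2⁻¹ * Φ x ^ 2 * (2 * (4 * (cd / r ^ 2))) :=
          add_le_add (h1.trans h3) h2
      _ = 4 * cϖ * S + (cϖ + 4 * cd) * Q := by rw [hQ]; ring
  have hLsum : |∑ μ, 4⁻¹ * KerrSchild.lagrangianCurrent G ϖ Φ x μ * n μ| ≤
      4 * cϖ * S + (cϖ + 4 * cd) * Q :=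
    (morawetzLeaf_abs_sum_mul_le (fun μ ↦ by
      rw [abs_mul, abs_of_pos (by norm_num : (0 : ℝ) < 4⁻¹)]
      exact mul_le_mul_of_nonneg_left (hL μ) (by norm_num)) hn).trans_eq (by ring)
  -- the Hardy current
  have hHsum : |∑ μ, 2⁻¹ * yv * Φ x ^ 2 * Y μ * n μ| ≤ 2 * cy * Q := by
    refine (morawetzLeaf_abs_sum_mul_le (B := 2⁻¹ * (cy / r ^ 2) * Φ x ^ 2) (fun μ ↦ ?_)
      hn).trans_eq (by rw [hQ]; ring)
    have h5 : |yv| * |Y μ| ≤ cy / r ^ 2 * 1 := mul_le_mul hy (hY μ) (abs_nonneg _) (by positivity)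
    rw [abs_mul, abs_mul, abs_mul, abs_of_pos (by norm_num : (0 : ℝ) < 2⁻¹),
      abs_of_nonneg (sq_nonneg (Φ x))]
    calc 2⁻¹ * |yv| * Φ x ^ 2 * |Y μ| = 2⁻¹ * Φ x ^ 2 * (|yv| * |Y μ|) := by ring
      _ ≤ 2⁻¹ * Φ x ^ 2 * (cy / r ^ 2 * 1) := mul_le_mul_of_nonneg_left h5 (by positivity)
      _ = 2⁻¹ * (cy / r ^ 2) * Φ x ^ 2 := by ring
  -- assemble
  conv_lhs => simp only [add_mul, Finset.sum_add_distrib]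
  refine ((abs_add_le _ _).trans (add_le_add (abs_add_three _ _ _) le_rfl)).trans ?_
  refine (add_le_add (add_le_add (add_le_add hJX hLsum) hHsum) hJT).trans ?_
  nlinarith [mul_nonneg hcd hS0, mul_nonneg hcy hS0, mul_nonneg hcϖ hQ0]

/-! ### The tails-cut profile, coefficients and multiplier on `{r > 2M}` -/

/-- On `{r > 2M}` the tails-cut profile `μ = χ(2 − r/8M) · 2H`, `H = M/r`, lies in `[0, 1]`
(`0 ≤ χ ≤ 1`, `0 ≤ 2M/r < 1`). [folklore] -/
theorem morawetzLeaf_profile_mem {M : ℝ} (hM : 0 < M) {x : E4} (hx : 2 * M < Kerr.radius 0 x) :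
    0 ≤ Real.smoothTransition (2 - Kerr.radius 0 x / (8 * M)) * (2 * Kerr.scalarH M 0 x) ∧
      Real.smoothTransition (2 - Kerr.radius 0 x / (8 * M)) * (2 * Kerr.scalarH M 0 x) ≤ 1 := by
  have hr : 0 < Kerr.radius 0 x := lt_trans (by positivity) hx
  have hχ0 := Real.smoothTransition.nonneg (2 - Kerr.radius 0 x / (8 * M))
  have hχ1 := Real.smoothTransition.le_one (2 - Kerr.radius 0 x / (8 * M))
  have hH0 : 0 ≤ Kerr.scalarH M 0 x := Kerr.scalarH_nonneg hM.le 0 x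
  have hH1 : 2 * Kerr.scalarH M 0 x ≤ 1 := by
    rw [hardy_scalarH_zero, mul_div_assoc', div_le_one hr]
    exact hx.le
  exact ⟨mul_nonneg hχ0 (by positivity),
    (mul_le_mul hχ1 hH1 (by positivity) zero_le_one).trans_eq (one_mul 1)⟩

/-- `|G₀^{αβ}| ≤ 2` on `{r > 2M}` for the tails-cut coefficient field `G₀ = η⁻¹ − μ ℓ♯ ⊗ ℓ♯`
(`|η^{αβ}| ≤ 1`, `0 ≤ μ ≤ 1`, `|(ℓ♯)^α| ≤ 1`). [folklore] -/
theorem morawetzLeaf_abs_inverseMetric_le {M : ℝ} (hM : 0 < M) {x : E4}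
    (hx : 2 * M < Kerr.radius 0 x) (α β : Fin 4) :
    |KerrSchild.inverseMetric (fun y ↦ Real.smoothTransition (2 - Kerr.radius 0 y / (8 * M)) *
        (2 * Kerr.scalarH M 0 y)) (Kerr.nullVector 0) x α β| ≤ 2 := by
  obtain ⟨h0, h1⟩ := morawetzLeaf_profile_mem hM hx
  have hr : 0 < Kerr.radius 0 x := lt_trans (by positivity) hx
  have hl : ∀ μ, |Kerr.nullVector 0 x μ| ≤ 1 := fun μ ↦ Kerr.abs_nullVector_le_one hr μ
  have hη : |Kerr.etaComp α β| ≤ 1 := by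
    unfold Kerr.etaComp
    split_ifs <;> simp
  simp only [KerrSchild.inverseMetric]
  refine ((abs_sub _ _).trans (add_le_add hη ?_)).trans_eq (by norm_num : (1 : ℝ) + 1 = 2)
  rw [abs_mul, abs_mul, abs_of_nonneg h0]
  exact mul_le_one₀ (mul_le_one₀ h1 (abs_nonneg _) (hl α)) (abs_nonneg _) (hl β)

/-- `|x_α| ≤ r = ‖x⃗‖` for a spatial index `α ≠ 0` (`a = 0`). [folklore] -/
theorem morawetzLeaf_abs_apply_le_radius (x : E4) {α : Fin 4} (hα : α ≠ 0) :
    |x α| ≤ Kerr.radius 0 x := by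
  rw [Kerr.radius_zero_left]
  exact KerrSchild.abs_apply_le_spatialNorm x hα

/-- **`|X^α| ≤ 1`** on `{r > 2M}` for the Morawetz multiplier `X = F(r) ∂_{r*}`,
`X⁰ = F μ`, `Xⁱ = F (1 − μ) xⁱ/r`, `F = 1 − 3M/r ∈ (−½, 1)`. [folklore] -/
theorem morawetzLeaf_abs_multiplier_le {M : ℝ} (hM : 0 < M) {x : E4}
    (hx : 2 * M < Kerr.radius 0 x) (α : Fin 4) :
    |(if α = 0 then (1 - 3 * M / Kerr.radius 0 x) *
        (Real.smoothTransition (2 - Kerr.radius 0 x / (8 * M)) * (2 * Kerr.scalarH M 0 x))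
      else (1 - 3 * M / Kerr.radius 0 x) *
        (1 - (Real.smoothTransition (2 - Kerr.radius 0 x / (8 * M)) * (2 * Kerr.scalarH M 0 x))) *
          x α / Kerr.radius 0 x)| ≤ 1 := by
  obtain ⟨h0, h1⟩ := morawetzLeaf_profile_mem hM hx
  have hr : 0 < Kerr.radius 0 x := lt_trans (by positivity) hx
  have hF : |1 - 3 * M / Kerr.radius 0 x| ≤ 1 := by
    have h3 : 3 * M / Kerr.radius 0 x ≤ 2 := by
      rw [div_le_iff₀ hr]
      linarith
    have h3' : 0 ≤ 3 * M / Kerr.radius 0 x := by positivity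
    rw [abs_le]
    constructor <;> linarith
  split_ifs with hα
  · rw [abs_mul, abs_of_nonneg h0]
    exact mul_le_one₀ hF h0 h1
  · rw [abs_div, abs_mul, abs_mul, abs_of_pos hr, div_le_one hr, abs_of_nonneg (sub_nonneg.2 h1)]
    exact (mul_le_mul (mul_le_one₀ hF (sub_nonneg.2 h1) (by linarith))
      (morawetzLeaf_abs_apply_le_radius x hα) (abs_nonneg _) zero_le_one).trans_eq (one_mul _)

/-- **`|(∂_{r*})^μ| ≤ 1`** on `{r > 2M}`: `(∂_{r*})⁰ = μ ∈ [0, 1]`, `(∂_{r*})ⁱ = (1 − μ) xⁱ/r`.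
[folklore] -/
theorem morawetzLeaf_abs_tortoise_le {M : ℝ} (hM : 0 < M) {x : E4}
    (hx : 2 * M < Kerr.radius 0 x) (μ : Fin 4) :
    |(if μ = 0 then Real.smoothTransition (2 - Kerr.radius 0 x / (8 * M)) * (2 * Kerr.scalarH M 0 x)
      else (1 - (Real.smoothTransition (2 - Kerr.radius 0 x / (8 * M)) * (2 * Kerr.scalarH M 0 x))) *
        x μ / Kerr.radius 0 x)| ≤ 1 := by
  obtain ⟨h0, h1⟩ := morawetzLeaf_profile_mem hM hx
  have hr : 0 < Kerr.radius 0 x := lt_trans (by positivity) hx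
  split_ifs with hμ
  · rw [abs_of_nonneg h0]
    exact h1
  · rw [abs_div, abs_mul, abs_of_pos hr, div_le_one hr, abs_of_nonneg (sub_nonneg.2 h1)]
    exact (mul_le_mul (by linarith) (morawetzLeaf_abs_apply_le_radius x hμ) (abs_nonneg _)
      zero_le_one).trans_eq (one_mul _)

/-- The conormal `n = (1, n⃗)` of a leaf of slope `≤ ½` (`∑ nᵢ² ≤ ¼`) has `|n_μ| ≤ 1`. [folklore] -/
theorem morawetzLeaf_abs_conormal_le {n : Fin 4 → ℝ} (hn0 : n 0 = 1)
    (hn : ∑ i : Fin 3, n i.succ ^ 2 ≤ 4⁻¹) (μ : Fin 4) : |n μ| ≤ 1 := by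
  by_cases hμ : μ = 0
  · rw [hμ, hn0, abs_one]
  · obtain ⟨i, rfl⟩ : ∃ i : Fin 3, μ = i.succ := ⟨μ.pred hμ, (Fin.succ_pred μ hμ).symm⟩
    have hle : n i.succ ^ 2 ≤ ∑ j : Fin 3, n j.succ ^ 2 :=
      Finset.single_le_sum (f := fun j : Fin 3 ↦ n j.succ ^ 2) (fun j _ ↦ sq_nonneg _)
        (Finset.mem_univ i)
    exact abs_le_one_iff_mul_self_le_one.mpr (by nlinarith)

/-! ### The Lagrangian weight `ϖ₂`, its gradient, and the Hardy weight -/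

/-- **`|ϖ₂(s)| ≤ 8/s` for `s > 2M`**, `ϖ₂(s) = 2(1 − 2M/s)((2s − 3M)/s² − M³(s − 3M)²/s⁶)`:
`s⁷ ϖ₂/2 = (s − 2M)((2s − 3M)s⁴ − M³(s − 3M)²)` has absolute value `≤ 4s⁶` on `s ≥ 2M`
(after `s = 2M + u`, `u ≥ 0`, both `4s⁶ ± (…)` have nonnegative coefficients). [folklore] -/
theorem morawetzLeaf_abs_weight_le {M s : ℝ} (hM : 0 < M) (hs : 2 * M < s) :
    |2 * ((1 - 2 * M / s) * ((2 * s - 3 * M) / s ^ 2 - M ^ 3 * (s - 3 * M) ^ 2 / s ^ 6))| ≤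
      8 / s := by
  have hs0 : 0 < s := lt_trans (by positivity) hs
  have hs' : s ≠ 0 := hs0.ne'
  obtain ⟨u, hu, hsu⟩ : ∃ u : ℝ, 0 ≤ u ∧ s = 2 * M + u := ⟨s - 2 * M, by linarith, by ring⟩
  have hrepr : 2 * ((1 - 2 * M / s) * ((2 * s - 3 * M) / s ^ 2 - M ^ 3 * (s - 3 * M) ^ 2 / s ^ 6)) =
      2 * ((s - 2 * M) * ((2 * s - 3 * M) * s ^ 4 - M ^ 3 * (s - 3 * M) ^ 2)) / s ^ 7 := by
    field_simp
  have hN : |(s - 2 * M) * ((2 * s - 3 * M) * s ^ 4 - M ^ 3 * (s - 3 * M) ^ 2)| ≤ 4 * s ^ 6 := by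
    subst hsu
    rw [abs_le]
    constructor
    · have h' : 0 ≤ 6 * u ^ 6 + 65 * M * u ^ 5 + 296 * M ^ 2 * u ^ 4 + 727 * M ^ 3 * u ^ 3 +
          1026 * M ^ 4 * u ^ 2 + 783 * M ^ 5 * u + 256 * M ^ 6 := by positivity
      linarith
    · have h' : 0 ≤ 2 * u ^ 6 + 31 * M * u ^ 5 + 184 * M ^ 2 * u ^ 4 + 553 * M ^ 3 * u ^ 3 +
          894 * M ^ 4 * u ^ 2 + 753 * M ^ 5 * u + 256 * M ^ 6 := by positivity
      linarith
  rw [hrepr, abs_div, abs_mul, abs_two, abs_of_pos (by positivity : (0 : ℝ) < s ^ 7),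
    div_le_div_iff₀ (by positivity) hs0]
  have h2 := mul_le_mul_of_nonneg_right hN hs0.le
  calc 2 * |(s - 2 * M) * ((2 * s - 3 * M) * s ^ 4 - M ^ 3 * (s - 3 * M) ^ 2)| * s
      = 2 * (|(s - 2 * M) * ((2 * s - 3 * M) * s ^ 4 - M ^ 3 * (s - 3 * M) ^ 2)| * s) := by ring
    _ ≤ 2 * (4 * s ^ 6 * s) := by linarith
    _ = 8 * s ^ 7 := by ring

/-- **The numerator of `ϖ₂′/2` is `O(s⁶)` on `s ≥ 2M`**: with
`N(s) = −2s⁶ + 14Ms⁵ − 18M²s⁴ + 4M³s³ − 40M⁴s² + 126M⁵s − 126M⁶` (`hasDerivAt_morawetzWeight`: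
`(ϖ₂/2)′ = N/s⁸`), `|N(s)| ≤ 10 s⁶` for `s > 2M` (after `s = 2M + u`, `u ≥ 0`, both `10s⁶ ± N`
have nonnegative coefficients). [folklore] -/
theorem morawetzLeaf_abs_weightDeriv_numerator_le {M s : ℝ} (hM : 0 < M) (hs : 2 * M < s) :
    |(-2 * s ^ 6 + 14 * M * s ^ 5 - 18 * M ^ 2 * s ^ 4 + 4 * M ^ 3 * s ^ 3 - 40 * M ^ 4 * s ^ 2 +
        126 * M ^ 5 * s - 126 * M ^ 6)| ≤ 10 * s ^ 6 := by
  obtain ⟨u, hu, hsu⟩ : ∃ u : ℝ, 0 ≤ u ∧ s = 2 * M + u := ⟨s - 2 * M, by linarith, by ring⟩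
  subst hsu
  rw [abs_le]
  constructor
  · have h' : 0 ≤ 8 * u ^ 6 + 110 * M * u ^ 5 + 602 * M ^ 2 * u ^ 4 + 1700 * M ^ 3 * u ^ 3 +
        2592 * M ^ 4 * u ^ 2 + 2094 * M ^ 5 * u + 670 * M ^ 6 := by positivity
    linarith
  · have h' : 0 ≤ 12 * u ^ 6 + 130 * M * u ^ 5 + 598 * M ^ 2 * u ^ 4 + 1500 * M ^ 3 * u ^ 3 +
        2208 * M ^ 4 * u ^ 2 + 1746 * M ^ 5 * u + 610 * M ^ 6 := by positivity
    linarith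

/-- The radial covector `x¹dx¹ + x²dx² + x³dx³` on the coordinate vectors: `0` on `∂₀`, `x_ν` on
`∂_ν`, `ν ≠ 0`. [folklore] -/
theorem morawetzLeaf_radCovector_apply (x : E4) (ν : Fin 4) :
    ((x 1) • E4.dx 1 + (x 2) • E4.dx 2 + (x 3) • E4.dx 3) (E4.basisVector ν) =
      if ν = 0 then 0 else x ν := by
  fin_cases ν <;> simp

/-- **`|∂_ν ϖ₂| ≤ 20/r²` on `{r > 2M}`** for the radial weight `ϖ₂ ∘ r`: by the chain rule
through `r` (`hardy_hasFDerivAt_comp_radius`), `∂_ν(ϖ₂ ∘ r) = ϖ₂′(r) x_ν/r` (`ν ≠ 0`), `= 0`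
(`ν = 0`), and `|ϖ₂′(r)| = 2|N(r)|/r⁸ ≤ 20/r²`. [folklore] -/
theorem morawetzLeaf_abs_fderiv_weight_le {M : ℝ} (hM : 0 < M) {x : E4}
    (hx : 2 * M < Kerr.radius 0 x) (ν : Fin 4) :
    |fderiv ℝ (fun z ↦ (fun s ↦ 2 * ((1 - 2 * M / s) *
        ((2 * s - 3 * M) / s ^ 2 - M ^ 3 * (s - 3 * M) ^ 2 / s ^ 6))) (Kerr.radius 0 z)) x
        (E4.basisVector ν)| ≤ 20 / Kerr.radius 0 x ^ 2 := by
  have hLe : |(if ν = 0 then (0 : ℝ) else x ν)| ≤ Kerr.radius 0 x := by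
    split_ifs with h
    · rw [abs_zero]
      exact Kerr.radius_nonneg 0 x
    · exact morawetzLeaf_abs_apply_le_radius x h
  set r := Kerr.radius 0 x with hrdef
  have hr : 0 < r := lt_trans (by positivity) hx
  have hN := morawetzLeaf_abs_weightDeriv_numerator_le hM hx
  have hw := (hasDerivAt_morawetzWeight M r hM hr).const_mul 2
  set N := -2 * r ^ 6 + 14 * M * r ^ 5 - 18 * M ^ 2 * r ^ 4 + 4 * M ^ 3 * r ^ 3 - 40 * M ^ 4 * r ^ 2 +
    126 * M ^ 5 * r - 126 * M ^ 6 with hNdef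
  have hF : HasFDerivAt (fun z ↦ (fun s ↦ 2 * ((1 - 2 * M / s) *
      ((2 * s - 3 * M) / s ^ 2 - M ^ 3 * (s - 3 * M) ^ 2 / s ^ 6))) (Kerr.radius 0 z))
      ((2 * (N / r ^ 8) * r⁻¹) • ((x 1) • E4.dx 1 + (x 2) • E4.dx 2 + (x 3) • E4.dx 3)) x :=
    hardy_hasFDerivAt_comp_radius hrdef.symm hr hw
  rw [hF.fderiv, smul_apply, morawetzLeaf_radCovector_apply, smul_eq_mul, abs_mul]
  have hc : |2 * (N / r ^ 8) * r⁻¹| ≤ 20 / r ^ 3 := by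
    rw [abs_mul, abs_mul, abs_two, abs_div, abs_of_pos (pow_pos hr 8), abs_of_pos (inv_pos.2 hr),
      le_div_iff₀ (pow_pos hr 3)]
    have h8 : 2 * (|N| / r ^ 8) * r⁻¹ * r ^ 3 = 2 * |N| / r ^ 6 := by
      field_simp
    rw [h8, div_le_iff₀ (pow_pos hr 6)]
    linarith
  calc |2 * (N / r ^ 8) * r⁻¹| * |(if ν = 0 then (0 : ℝ) else x ν)|
      ≤ 20 / r ^ 3 * r := mul_le_mul hc hLe (abs_nonneg _) (by positivity)
    _ = 20 / r ^ 2 := by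
        field_simp

/-- The degree-5 Hardy polynomial `q_θ` is at most `10` in absolute value on `[0, 7]`
(termwise: `|q_θ(ρ)| ≤ ∑ |c_k| 7^k < 10`). [folklore] -/
theorem morawetzLeaf_abs_hardyPoly_le {ρ : ℝ} (h0 : 0 ≤ ρ) (h7 : ρ ≤ 7) :
    |(-((593459 : ℝ) / 10000000)) + (788874 : ℝ) / 10000000 * ρ - (383061 : ℝ) / 10000000 * ρ ^ 2 +
        (92031 : ℝ) / 10000000 * ρ ^ 3 - (10985 : ℝ) / 10000000 * ρ ^ 4 +
        (525 : ℝ) / 10000000 * ρ ^ 5| ≤ 10 := by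
  have h2 : ρ ^ 2 ≤ 7 ^ 2 := pow_le_pow_left₀ h0 h7 2
  have h3 : ρ ^ 3 ≤ 7 ^ 3 := pow_le_pow_left₀ h0 h7 3
  have h4 : ρ ^ 4 ≤ 7 ^ 4 := pow_le_pow_left₀ h0 h7 4
  have h5 : ρ ^ 5 ≤ 7 ^ 5 := pow_le_pow_left₀ h0 h7 5
  have g2 : 0 ≤ ρ ^ 2 := by positivity
  have g3 : 0 ≤ ρ ^ 3 := by positivity
  have g4 : 0 ≤ ρ ^ 4 := by positivity
  have g5 : 0 ≤ ρ ^ 5 := by positivity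
  rw [abs_le]
  constructor <;> nlinarith

/-- **`|ŷ(s)| ≤ 3500/s²` for `s > 2M`** for the Hardy weight
`ŷ(s) = 2(7M − s)² q_θ(s/M)/(M³ s)` on `s ≤ 7M`, `0` beyond: with `ρ = s/M ∈ (2, 7]`,
`s² ŷ(s) = 2(7 − ρ)² ρ q_θ(ρ)` and `2 · 25 · 7 · 10 = 3500`. [folklore] -/
theorem morawetzLeaf_abs_hardyWeight_le {M s : ℝ} (hM : 0 < M) (hs : 2 * M < s) :
    |(if s ≤ 7 * M then 2 * (7 * M - s) ^ 2 * (fun ρ ↦ (-((593459 : ℝ) / 10000000)) +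
        (788874 : ℝ) / 10000000 * ρ - (383061 : ℝ) / 10000000 * ρ ^ 2 +
        (92031 : ℝ) / 10000000 * ρ ^ 3 - (10985 : ℝ) / 10000000 * ρ ^ 4 +
        (525 : ℝ) / 10000000 * ρ ^ 5) (s / M) / (M ^ 3 * s) else 0)| ≤ 3500 / s ^ 2 := by
  have hs0 : 0 < s := lt_trans (by positivity) hs
  split_ifs with h7
  · have hρ0 : 0 ≤ s / M := by positivity
    have hρ7 : s / M ≤ 7 := by
      rw [div_le_iff₀ hM]
      linarith
    have hq := morawetzLeaf_abs_hardyPoly_le hρ0 hρ7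
    beta_reduce
    rw [abs_div, abs_mul, abs_mul, abs_two, abs_of_nonneg (sq_nonneg _),
      abs_of_pos (by positivity : (0 : ℝ) < M ^ 3 * s), div_le_div_iff₀ (by positivity) (by positivity)]
    have hA : (7 * M - s) ^ 2 ≤ 25 * M ^ 2 := by nlinarith
    have hB := mul_le_mul hA hq (abs_nonneg _) (by positivity)
    have key := mul_le_mul_of_nonneg_left (mul_le_mul hB h7 hs0.le (by positivity))
      (by positivity : (0 : ℝ) ≤ 2 * s)
    nlinarith [key]
  · rw [abs_zero]
    positivity

/-! ### The registered stub -/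

/-- **Stub `morawetz_leafFlux_abs_le`** (crux `AdiabaticMultiKerrILED`, line `Sketch`).
The boundary (leaf) terms of the weighted Morawetz identity of the tails-cut Schwarzschild zone:
for every `M > 0` there is `K ≥ 0` such that for every `Φ`, every point with `r > 2M` and every
conormal `n = (1, −∇F)` of a leaf of slope `≤ ½` (`∑ nᵢ² ≤ ¼`), the total current
`J_tot = J^X + ¼ L^{ϖ₂} + J_H + J^T` satisfies `|∑_μ J_tot^μ n_μ| ≤ K (∑_μ (∂_μΦ)² + Φ²/r²)`.
Proof: `morawetzLeaf_abs_sum_le_general` with the pointwise bounds `|G₀| ≤ 2`, `|X| ≤ 1`,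
`|∂_{r*}| ≤ 1`, `|n| ≤ 1`, `|ϖ₂| ≤ 8/r`, `|∂ϖ₂| ≤ 20/r²`, `|ŷ| ≤ 3500/r²` of this file
(`K = 96 + 32 + 80 + 7000`). Dafermos–Rodnianski–Shlapentokh-Rothman arXiv:1402.7034, §2.3.2;
Dafermos–Rodnianski arXiv:0811.0354, §4.1. [folklore] -/
theorem morawetz_leafFlux_abs_le : ∀ (M : ℝ), 0 < M → ∃ K : ℝ, 0 ≤ K ∧ ∀ (Φ : E4 → ℝ) (x : E4) (n : Fin 4 → ℝ), 2 * M < Kerr.radius 0 x →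
    n 0 = 1 → ∑ i : Fin 3, n i.succ ^ 2 ≤ 4⁻¹ →
    |∑ μ, (KerrSchild.multiplierCurrent (KerrSchild.inverseMetric (fun y ↦ Real.smoothTransition (2 - Kerr.radius 0 y / (8 * M)) * (2 * Kerr.scalarH M 0 y)) (Kerr.nullVector 0)) (fun (z : E4) (α : Fin 4) ↦ if α = 0 then (1 - 3 * M / Kerr.radius 0 z) * (Real.smoothTransition (2 - Kerr.radius 0 z / (8 * M)) * (2 * Kerr.scalarH M 0 z))
          else (1 - 3 * M / Kerr.radius 0 z) * (1 - (Real.smoothTransition (2 - Kerr.radius 0 z / (8 * M)) * (2 * Kerr.scalarH M 0 z))) * z α / Kerr.radius 0 z) Φ x μ +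
        4⁻¹ * KerrSchild.lagrangianCurrent (KerrSchild.inverseMetric (fun y ↦ Real.smoothTransition (2 - Kerr.radius 0 y / (8 * M)) * (2 * Kerr.scalarH M 0 y)) (Kerr.nullVector 0)) (fun z ↦ (fun s ↦ 2 * ((1 - 2 * M / s) * ((2 * s - 3 * M) / s ^ 2 - M ^ 3 * (s - 3 * M) ^ 2 / s ^ 6))) (Kerr.radius 0 z)) Φ x μ +
        2⁻¹ * (fun s ↦ if s ≤ 7 * M then 2 * (7 * M - s) ^ 2 * (fun ρ ↦ (-((593459 : ℝ) / 10000000)) + (788874 : ℝ) / 10000000 * ρ - (383061 : ℝ) / 10000000 * ρ ^ 2 + (92031 : ℝ) / 10000000 * ρ ^ 3 - (10985 : ℝ) / 10000000 * ρ ^ 4 + (525 : ℝ) / 10000000 * ρ ^ 5) (s / M) / (M ^ 3 * s) else 0) (Kerr.radius 0 x) * Φ x ^ 2 * (if μ = 0 then (Real.smoothTransition (2 - Kerr.radius 0 x / (8 * M)) * (2 * Kerr.scalarH M 0 x)) else (1 - (Real.smoothTransition (2 - Kerr.radius 0 x / (8 * M)) * (2 * Kerr.scalarH M 0 x))) * x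 μ / Kerr.radius 0 x) +
        KerrSchild.multiplierCurrent (KerrSchild.inverseMetric (fun y ↦ Real.smoothTransition (2 - Kerr.radius 0 y / (8 * M)) * (2 * Kerr.scalarH M 0 y)) (Kerr.nullVector 0)) KerrSchild.timeField Φ x μ) * n μ| ≤ K * (∑ μ, fderiv ℝ Φ x (E4.basisVector μ) ^ 2 + Φ x ^ 2 / Kerr.radius 0 x ^ 2) := by
  intro M hM
  refine ⟨96 + 4 * 8 + 4 * 20 + 2 * 3500, by norm_num, ?_⟩
  intro Φ x n hx hn0 hn
  have hr : 0 < Kerr.radius 0 x := lt_trans (by positivity) hx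
  exact morawetzLeaf_abs_sum_le_general _ _ _ Φ x n _ hr (by norm_num) (by norm_num) (by norm_num)
    (morawetzLeaf_abs_inverseMetric_le hM hx) (morawetzLeaf_abs_multiplier_le hM hx)
    (morawetzLeaf_abs_conormal_le hn0 hn) (morawetzLeaf_abs_tortoise_le hM hx)
    (morawetzLeaf_abs_weight_le hM hx) (morawetzLeaf_abs_fderiv_weight_le hM hx)
    (morawetzLeaf_abs_hardyWeight_le hM hx)

end Summit.FinalStateConjecture.FinalStateConjecture.Theorems

end
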